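import Summits.QuantumFields.YangMills.Theorems.BalabanUVNodesN15PartitionPeriodic
import HarnessLib

/-!
# THE QUADRATIC PARTITION OF UNITY (2.36), V: the THIRD-DIFFERENCE LETTER of the profile — CUBIC FLATNESS `Θ(1 − u) ≤ (π³∕3)u³` at the ends, the smooth carrier
# `g(t) = cos((π∕2)φ(t))` with `|g‴| ≤ 6π³`, and ON THE CIRCLE `|Θ_K(u+3s) − 3Θ_K(u+2s) + 3Θ_K(u+s) − Θ_K(u)| ≤ 72π³s³` (`0 ≤ s ≤ 1∕3`, `K ≥ 2`) — the `C^{2,1}` letter the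
# second-derivative two-grid fit `o₂` of FILE 46 needs (dag-n15-w4 g0, width seat on N15 = NE2; dag-n15-c g11's located item (Γ17); s1 «background-layer OPERATOR ingredient»)

Cell `pub-ymgap`, seat `pub-ymgap-dag-n15-w4` (director №399 (3a) width; HUMAN RULING D-0062), generation 0.  `bears_on: R4∕N15 · K3⁷ SpineGivenEndpointR13SepCoPH
(stmt-QuantumFields-20544)`.  Filed `--supports stmt-QuantumFields-20544 --as helper` — COUNT-NEUTRAL.  Theorems only (0 `def`, 0 `sorry`).  Imports BY NAME dag-n15-c FILE 60
`…N15PartitionPeriodic` (`cenRep`, `thetaPer`, `abs_cenRep_le`, `abs_abs_cenRep_sub_le`, `thetaPer_eq_of_abs_le`, `thetaP_abs`, `thetaPer_nonneg`) and through it FILE 59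
`…N15PartitionProfile` (`phiP`, `thetaP`, `phiP_neg`, `phiP_sub_one`, `phiP_le_sq`, `thetaP_of_abs_le`, `thetaP_eq_zero_of_one_le_abs`); Mathlib calculus (`HasDerivAt`, the mean
value theorem `exists_hasDerivAt_eq_slope`, `Real.sin_ge_sub_cube`).  Nothing in the tree is modified.

WHY.  FILE 46 `hasMaj_idef_commOp_lapOp_comp` (the η-defect of the (2.134) row of the two-spacing gluing) displays, besides the first-derivative fit `o₁` (FILE 64), the fit of the
SECOND derivative `|∇′*∇′h′ − (∇*∇h)∘π| ≤ o₂` of the partition at two spacings.  For the sampled partition `h_k = Π_ν Θ_K(ξ_ν − k_ν)` (FILE 61) the comparison of second difference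
quotients at steps `s′` and `s = Ls′` telescopes against a THIRD-difference letter of the one-dimensional profile — exactly as FILE 64's `o₁` telescoped against FILE 60's
second-difference letter.  `Θ` is `C²` but only `C^{2,1}` across `±1` (inside, `Θ(1 − u) = sin((π∕2)φ(u)) ~ (π³∕3)u³`; outside `0`), which is what a third-difference bound
`O(s³)` needs.  THIS FILE: §1 ★ `thetaP_one_sub_le_cube` — `Θ(1 − u) ≤ (π³∕3)u³` (`x − sin x ≤ x³∕6`), `thetaP_le_cube_of_le_abs` (absolute-value form); §2 the smooth carrier
`t ↦ cos((π∕2)φ(t))` agreeing with `Θ` on `[−1, 1]`: its three derivatives by the chain∕product rules (`hasDerivAt_phiP`, `hasDerivAt_cos_phiP`, `…_deriv`, `…_deriv2`), the bound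
`abs_cos_phiP_deriv3_le` (`|g‴| ≤ π³ + 3π³ + 2π³`), the generic ★★ `abs_third_diff_le_of_hasDerivAt` (three mean-value steps: `Δ_h³f(x) = h·(Δ_h²f)′(ξ₁) = h²·(Δ_hf″)(ξ₂)∕… = h³f‴(ξ₃)`)
and ★★ `abs_cos_phiP_third_diff_le` (`≤ 6π³h³`); §3 ★★★ `abs_thetaPer_third_diff_le` — on the circle of `K ≥ 2` cubes, `0 ≤ s ≤ 1∕3`: centre `c = u + 3s∕2`, representative
`r = c − jK`, `|r| ≤ K∕2`; if `|r| ≤ 1 − 3s∕2` the four points have the common representative window `[−1, 1] ⊆ [−K∕2, K∕2]` (FILE 60 `thetaPer_eq_of_abs_le`) and §2 applies;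
otherwise every one of the four values is `≤ (π³∕3)(3s)³ = 9π³s³` by §1 and the 1-Lipschitz circle distance (`abs_abs_cenRep_sub_le`), so the third difference is `≤ 8·9π³s³`.

HONEST FRAMING ∕ LIMITS.  Elementary real analysis (trigonometric letters, three applications of the mean value theorem); [B6] (2.36) p.229 («|∂^α h_□| ≤ O(1)M^{−|α|}») and [B9]
Thm 3.14 pp.426–427 (the two-grid difference template) are SHAPES only — nothing of [B5]∕[B6]∕[B9] asserted; the profile is FILE 59's choice.  The second-derivative fit `o₂`
itself (the telescoping on the product carriers) is the sequel, not this file.  NE2⁺ NOT PRINTED, NOT proved; N15 NOT discharged; counts of record UNMOVED (typed 28∕28 ·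
discharged 5∕27); one finite 𝕋⁴ at fixed ε — NOT infinite volume, NOT OS on ℝ⁴, NOT a mass gap, NOT Clay; R4 closes the conditional finite-𝕋⁴ rung `BalabanLadder.UV` only.
Restate-immune (no Theses import).
-/

noncomputable section

namespace Summit.QuantumFields.YangMills.BalabanUVNodes.N15.Gluing

open Real Set

/-! ## §1 Cubic flatness of the profile at the ends -/

/-- `φ(u) ≤ (2π²∕3)u³` for `u ≥ 0` (`x − sin x ≤ x³∕6` at `x = 2πu`). [folklore] -/
theorem phiP_le_cube {u : ℝ} (hu : 0 ≤ u) : phiP u ≤ 2 * π ^ 2 / 3 * u ^ 3 := by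
  unfold phiP
  have hπ : 0 < 2 * π := by positivity
  have h := Real.sin_ge_sub_cube (x := 2 * π * u) (by positivity)
  have key : u - Real.sin (2 * π * u) / (2 * π) = (2 * π * u - Real.sin (2 * π * u)) / (2 * π) := by field_simp
  have e : (2 * π * u) ^ 3 / 6 = 2 * π ^ 2 / 3 * u ^ 3 * (2 * π) := by ring
  rw [key, div_le_iff₀ hπ]
  linarith

/-- ★ **CUBIC FLATNESS AT THE ENDS**: `Θ(1 − u) = sin((π∕2)φ(u)) ≤ (π³∕3)u³` for `0 ≤ u ≤ 2` (⟹ `Θ` is `C^{2,1}` across `±1`). [folklore] -/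
theorem thetaP_one_sub_le_cube {u : ℝ} (h0 : 0 ≤ u) (h2 : u ≤ 2) : thetaP (1 - u) ≤ π ^ 3 / 3 * u ^ 3 := by
  have hu : |1 - u| ≤ 1 := abs_le.2 ⟨by linarith, by linarith⟩
  have hφ : phiP (1 - u) = 1 - phiP u := by
    rw [show (1 : ℝ) - u = -(u - 1) by ring, phiP_neg, phiP_sub_one]; ring
  rw [thetaP_of_abs_le hu, hφ, show π / 2 * (1 - phiP u) = π / 2 - π / 2 * phiP u by ring, Real.cos_pi_div_two_sub]
  obtain ⟨hφ0, _⟩ := phiP_le_sq h0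
  calc Real.sin (π / 2 * phiP u) ≤ π / 2 * phiP u := Real.sin_le (by positivity)
    _ ≤ π / 2 * (2 * π ^ 2 / 3 * u ^ 3) := mul_le_mul_of_nonneg_left (phiP_le_cube h0) (by positivity)
    _ = π ^ 3 / 3 * u ^ 3 := by ring

/-- Cubic flatness in absolute-value form: `1 − c ≤ |t|`, `0 ≤ c ≤ 1` ⟹ `Θ(t) ≤ (π³∕3)c³`. [folklore] -/
theorem thetaP_le_cube_of_le_abs {t c : ℝ} (hc0 : 0 ≤ c) (hc1 : c ≤ 1) (ht : 1 - c ≤ |t|) : thetaP t ≤ π ^ 3 / 3 * c ^ 3 := by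
  by_cases h1 : 1 ≤ |t|
  · rw [thetaP_eq_zero_of_one_le_abs h1]; positivity
  · push Not at h1
    rw [← thetaP_abs, show |t| = 1 - (1 - |t|) by ring]
    refine (thetaP_one_sub_le_cube (u := 1 - |t|) (by linarith) (by linarith [abs_nonneg t])).trans ?_
    have : (1 - |t|) ^ 3 ≤ c ^ 3 := pow_le_pow_left₀ (by linarith) (by linarith) 3
    exact mul_le_mul_of_nonneg_left this (by positivity)

/-! ## §2 The smooth carrier `g(t) = cos((π∕2)φ(t))`: three derivatives, `|g‴| ≤ 6π³`, the third difference -/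

/-- `φ′(t) = 1 − cos(2πt)`. [folklore] -/
theorem hasDerivAt_phiP (t : ℝ) : HasDerivAt phiP (1 - Real.cos (2 * π * t)) t := by
  have hπ : (2 * π : ℝ) ≠ 0 := by positivity
  have h1 : HasDerivAt (fun t : ℝ => 2 * π * t) (2 * π) t := by simpa using (hasDerivAt_id t).const_mul (2 * π)
  have h2 : HasDerivAt (fun t : ℝ => Real.sin (2 * π * t) / (2 * π)) (Real.cos (2 * π * t) * (2 * π) / (2 * π)) t := h1.sin.div_const _
  have h3 := (hasDerivAt_id' (x := t)).fun_sub h2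
  unfold phiP
  refine h3.congr_deriv ?_
  rw [mul_div_assoc, div_self hπ, mul_one]

/-- `((π∕2)φ)′ = (π∕2)(1 − cos 2πt)`. [folklore] -/
theorem hasDerivAt_halfpi_phiP (t : ℝ) : HasDerivAt (fun t => π / 2 * phiP t) (π / 2 * (1 - Real.cos (2 * π * t))) t :=
  (hasDerivAt_phiP t).const_mul _

/-- `((π∕2)(1 − cos 2πt))′ = π²·sin 2πt`. [folklore] -/
theorem hasDerivAt_halfpi_phiP_deriv (t : ℝ) : HasDerivAt (fun t => π / 2 * (1 - Real.cos (2 * π * t))) (π ^ 2 * Real.sin (2 * π * t)) t := by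
  have h1 : HasDerivAt (fun t : ℝ => 2 * π * t) (2 * π) t := by simpa using (hasDerivAt_id t).const_mul (2 * π)
  have h2 := ((hasDerivAt_const t (1 : ℝ)).fun_sub h1.cos).const_mul (π / 2)
  refine h2.congr_deriv ?_
  ring

/-- `(π²·sin 2πt)′ = 2π³·cos 2πt`. [folklore] -/
theorem hasDerivAt_halfpi_phiP_deriv2 (t : ℝ) : HasDerivAt (fun t => π ^ 2 * Real.sin (2 * π * t)) (2 * π ^ 3 * Real.cos (2 * π * t)) t := by
  have h1 : HasDerivAt (fun t : ℝ => 2 * π * t) (2 * π) t := by simpa using (hasDerivAt_id t).const_mul (2 * π)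
  refine (h1.sin.const_mul (π ^ 2)).congr_deriv ?_
  ring

/-- `g′ = −sin((π∕2)φ)·(π∕2)(1 − cos 2πt)` for `g = cos((π∕2)φ)`. [folklore] -/
theorem hasDerivAt_cos_phiP (t : ℝ) :
    HasDerivAt (fun t => Real.cos (π / 2 * phiP t)) (-Real.sin (π / 2 * phiP t) * (π / 2 * (1 - Real.cos (2 * π * t)))) t :=
  (hasDerivAt_halfpi_phiP t).cos

/-- `g″ = −cos((π∕2)φ)·((π∕2)(1 − cos 2πt))² − sin((π∕2)φ)·π² sin 2πt`. [folklore] -/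
theorem hasDerivAt_cos_phiP_deriv (t : ℝ) :
    HasDerivAt (fun t => -Real.sin (π / 2 * phiP t) * (π / 2 * (1 - Real.cos (2 * π * t))))
      (-Real.cos (π / 2 * phiP t) * (π / 2 * (1 - Real.cos (2 * π * t))) ^ 2 - Real.sin (π / 2 * phiP t) * (π ^ 2 * Real.sin (2 * π * t))) t := by
  have h1 : HasDerivAt (fun t => -Real.sin (π / 2 * phiP t)) (-(Real.cos (π / 2 * phiP t) * (π / 2 * (1 - Real.cos (2 * π * t))))) t :=
    (hasDerivAt_halfpi_phiP t).sin.fun_neg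
  refine (h1.fun_mul (hasDerivAt_halfpi_phiP_deriv t)).congr_deriv ?_
  ring

/-- `g‴ = sin((π∕2)φ)·((π∕2)(1 − cos 2πt))³ − 3cos((π∕2)φ)·(π∕2)(1 − cos 2πt)·π² sin 2πt − sin((π∕2)φ)·2π³ cos 2πt`. [folklore] -/
theorem hasDerivAt_cos_phiP_deriv2 (t : ℝ) :
    HasDerivAt (fun t => -Real.cos (π / 2 * phiP t) * (π / 2 * (1 - Real.cos (2 * π * t))) ^ 2 - Real.sin (π / 2 * phiP t) * (π ^ 2 * Real.sin (2 * π * t)))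
      (Real.sin (π / 2 * phiP t) * (π / 2 * (1 - Real.cos (2 * π * t))) ^ 3
        - 3 * Real.cos (π / 2 * phiP t) * (π / 2 * (1 - Real.cos (2 * π * t))) * (π ^ 2 * Real.sin (2 * π * t))
        - Real.sin (π / 2 * phiP t) * (2 * π ^ 3 * Real.cos (2 * π * t))) t := by
  have hA := hasDerivAt_halfpi_phiP t
  have hA1 := hasDerivAt_halfpi_phiP_deriv t
  have h1 : HasDerivAt (fun t => -Real.cos (π / 2 * phiP t)) (-(-Real.sin (π / 2 * phiP t) * (π / 2 * (1 - Real.cos (2 * π * t))))) t := hA.cos.fun_neg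
  have h2 : HasDerivAt (fun t => (π / 2 * (1 - Real.cos (2 * π * t))) ^ 2)
      (2 * (π / 2 * (1 - Real.cos (2 * π * t))) * (π ^ 2 * Real.sin (2 * π * t))) t := by
    have h : HasDerivAt (fun t => (π / 2 * (1 - Real.cos (2 * π * t))) * (π / 2 * (1 - Real.cos (2 * π * t))))
        (2 * (π / 2 * (1 - Real.cos (2 * π * t))) * (π ^ 2 * Real.sin (2 * π * t))) t := (hA1.fun_mul hA1).congr_deriv (by ring)
    exact h.congr_of_eventuallyEq (Filter.Eventually.of_forall fun x => by simp only [pow_two])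
  have h3 : HasDerivAt (fun t => Real.sin (π / 2 * phiP t)) (Real.cos (π / 2 * phiP t) * (π / 2 * (1 - Real.cos (2 * π * t)))) t := hA.sin
  have h := (h1.fun_mul h2).fun_sub (h3.fun_mul (hasDerivAt_halfpi_phiP_deriv2 t))
  refine h.congr_deriv ?_
  ring

/-- `|g‴| ≤ 6π³` (`|(π∕2)(1 − cos)| ≤ π`, `|π² sin| ≤ π²`, `|2π³ cos| ≤ 2π³`). [folklore] -/
theorem abs_cos_phiP_deriv3_le (t : ℝ) :
    |Real.sin (π / 2 * phiP t) * (π / 2 * (1 - Real.cos (2 * π * t))) ^ 3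
        - 3 * Real.cos (π / 2 * phiP t) * (π / 2 * (1 - Real.cos (2 * π * t))) * (π ^ 2 * Real.sin (2 * π * t))
        - Real.sin (π / 2 * phiP t) * (2 * π ^ 3 * Real.cos (2 * π * t))| ≤ 6 * π ^ 3 := by
  set S := Real.sin (π / 2 * phiP t) with hS
  set Co := Real.cos (π / 2 * phiP t) with hCo
  set A1 := π / 2 * (1 - Real.cos (2 * π * t)) with hA1
  set A2 := π ^ 2 * Real.sin (2 * π * t) with hA2
  set A3 := 2 * π ^ 3 * Real.cos (2 * π * t) with hA3
  have bS : |S| ≤ 1 := Real.abs_sin_le_one _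
  have bCo : |Co| ≤ 1 := Real.abs_cos_le_one _
  have hc := abs_le.1 (Real.abs_cos_le_one (2 * π * t))
  have bA1 : |A1| ≤ π := by
    rw [hA1, abs_mul, abs_of_pos (by positivity : (0 : ℝ) < π / 2), abs_of_nonneg (by linarith)]
    nlinarith [Real.pi_pos]
  have bA2 : |A2| ≤ π ^ 2 := by
    rw [hA2, abs_mul, abs_of_pos (by positivity : (0 : ℝ) < π ^ 2)]
    exact mul_le_of_le_one_right (by positivity) (Real.abs_sin_le_one _)
  have bA3 : |A3| ≤ 2 * π ^ 3 := by
    rw [hA3, abs_mul, abs_of_pos (by positivity : (0 : ℝ) < 2 * π ^ 3)]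
    exact mul_le_of_le_one_right (by positivity) (Real.abs_cos_le_one _)
  have t1 : |S * A1 ^ 3| ≤ π ^ 3 := by
    rw [abs_mul, abs_pow]
    calc |S| * |A1| ^ 3 ≤ 1 * π ^ 3 := mul_le_mul bS (pow_le_pow_left₀ (abs_nonneg _) bA1 3) (by positivity) zero_le_one
      _ = π ^ 3 := one_mul _
  have t2 : |3 * Co * A1 * A2| ≤ 3 * π ^ 3 := by
    rw [abs_mul, abs_mul, abs_mul, abs_of_pos (by norm_num : (0 : ℝ) < 3)]
    have := mul_le_mul (mul_le_mul bCo bA1 (abs_nonneg _) zero_le_one) bA2 (abs_nonneg _) (by positivity)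
    calc 3 * |Co| * |A1| * |A2| = 3 * (|Co| * |A1| * |A2|) := by ring
      _ ≤ 3 * (1 * π * π ^ 2) := mul_le_mul_of_nonneg_left this (by norm_num)
      _ = 3 * π ^ 3 := by ring
  have t3 : |S * A3| ≤ 2 * π ^ 3 := by
    rw [abs_mul]
    calc |S| * |A3| ≤ 1 * (2 * π ^ 3) := mul_le_mul bS bA3 (abs_nonneg _) zero_le_one
      _ = 2 * π ^ 3 := one_mul _
  calc |S * A1 ^ 3 - 3 * Co * A1 * A2 - S * A3| ≤ |S * A1 ^ 3 - 3 * Co * A1 * A2| + |S * A3| := abs_sub _ _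
    _ ≤ |S * A1 ^ 3| + |3 * Co * A1 * A2| + |S * A3| := add_le_add (abs_sub _ _) le_rfl
    _ ≤ π ^ 3 + 3 * π ^ 3 + 2 * π ^ 3 := add_le_add (add_le_add t1 t2) t3
    _ = 6 * π ^ 3 := by ring

/-- One mean-value step: `F(a + h) − F(a) = h·F′(c)` for some `c`, `h > 0`. [folklore] -/
theorem exists_sub_eq_mul_of_hasDerivAt {F F' : ℝ → ℝ} (hF : ∀ x, HasDerivAt F (F' x) x) (a : ℝ) {h : ℝ} (hh : 0 < h) :
    ∃ c, F (a + h) - F a = h * F' c := by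
  obtain ⟨c, _, hc⟩ := exists_hasDerivAt_eq_slope F F' (by linarith : a < a + h)
    (fun z _ => (hF z).continuousAt.continuousWithinAt) (fun z _ => hF z)
  refine ⟨c, ?_⟩
  rw [hc, add_sub_cancel_left]
  field_simp

/-- ★★ **THE THIRD DIFFERENCE FROM THE THIRD DERIVATIVE** (three mean-value steps): `|f‴| ≤ C` everywhere ⟹
`|f(x + 3h) − 3f(x + 2h) + 3f(x + h) − f(x)| ≤ C·h³` for `h ≥ 0`. [folklore] -/
theorem abs_third_diff_le_of_hasDerivAt {f f₁ f₂ f₃ : ℝ → ℝ} {C : ℝ} (h₁ : ∀ x, HasDerivAt f (f₁ x) x) (h₂ : ∀ x, HasDerivAt f₁ (f₂ x) x)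
    (h₃ : ∀ x, HasDerivAt f₂ (f₃ x) x) (hC : ∀ x, |f₃ x| ≤ C) (x : ℝ) {h : ℝ} (hh : 0 ≤ h) :
    |f (x + 3 * h) - 3 * f (x + 2 * h) + 3 * f (x + h) - f x| ≤ C * h ^ 3 := by
  rcases eq_or_lt_of_le hh with heq | hpos
  · rw [← heq]
    have e : f (x + 3 * 0) - 3 * f (x + 2 * 0) + 3 * f (x + 0) - f x = 0 := by simp only [mul_zero, add_zero]; ring
    rw [e]; simp
  -- first step on F₂(w) = f(w + 2h) − 2f(w + h) + f(w)
  have hF2 : ∀ w, HasDerivAt (fun w => f (w + 2 * h) - 2 * f (w + h) + f w) (f₁ (w + 2 * h) - 2 * f₁ (w + h) + f₁ w) w := fun w =>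
    (((h₁ (w + 2 * h)).comp_add_const w (2 * h)).fun_sub (((h₁ (w + h)).comp_add_const w h).const_mul 2)).fun_add (h₁ w)
  obtain ⟨ξ₁, e₁⟩ := exists_sub_eq_mul_of_hasDerivAt hF2 x hpos
  -- second step on F₁(w) = f′(w + h) − f′(w)
  have hF1 : ∀ w, HasDerivAt (fun w => f₁ (w + h) - f₁ w) (f₂ (w + h) - f₂ w) w := fun w =>
    ((h₂ (w + h)).comp_add_const w h).fun_sub (h₂ w)
  obtain ⟨ξ₂, e₂⟩ := exists_sub_eq_mul_of_hasDerivAt hF1 ξ₁ hpos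
  -- third step on f″
  obtain ⟨ξ₃, e₃⟩ := exists_sub_eq_mul_of_hasDerivAt h₃ ξ₂ hpos
  have e₁' : f (x + 3 * h) - 3 * f (x + 2 * h) + 3 * f (x + h) - f x = h * (f₁ (ξ₁ + 2 * h) - 2 * f₁ (ξ₁ + h) + f₁ ξ₁) := by
    have := e₁
    rw [show x + h + 2 * h = x + 3 * h by ring, show x + h + h = x + 2 * h by ring] at this
    linarith
  have e₂' : f₁ (ξ₁ + 2 * h) - 2 * f₁ (ξ₁ + h) + f₁ ξ₁ = h * (f₂ (ξ₂ + h) - f₂ ξ₂) := by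
    have := e₂
    rw [show ξ₁ + h + h = ξ₁ + 2 * h by ring] at this
    linarith
  have key : f (x + 3 * h) - 3 * f (x + 2 * h) + 3 * f (x + h) - f x = h ^ 3 * f₃ ξ₃ := by
    rw [e₁', e₂', e₃]; ring
  rw [key, abs_mul, abs_of_nonneg (pow_nonneg hh 3)]
  calc h ^ 3 * |f₃ ξ₃| ≤ h ^ 3 * C := mul_le_mul_of_nonneg_left (hC ξ₃) (pow_nonneg hh 3)
    _ = C * h ^ 3 := mul_comm _ _

/-- ★★ **THE THIRD DIFFERENCE OF THE SMOOTH CARRIER**: `|g(x+3h) − 3g(x+2h) + 3g(x+h) − g(x)| ≤ 6π³h³` for `g = cos((π∕2)φ)`, `h ≥ 0`. [folklore] -/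
theorem abs_cos_phiP_third_diff_le (x : ℝ) {h : ℝ} (hh : 0 ≤ h) :
    |Real.cos (π / 2 * phiP (x + 3 * h)) - 3 * Real.cos (π / 2 * phiP (x + 2 * h)) + 3 * Real.cos (π / 2 * phiP (x + h)) - Real.cos (π / 2 * phiP x)|
      ≤ 6 * π ^ 3 * h ^ 3 :=
  abs_third_diff_le_of_hasDerivAt (f := fun t => Real.cos (π / 2 * phiP t)) hasDerivAt_cos_phiP hasDerivAt_cos_phiP_deriv hasDerivAt_cos_phiP_deriv2
    abs_cos_phiP_deriv3_le x hh

/-! ## §3 The third-difference letter on the circle -/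

/-- ★★★ **THE THIRD-DIFFERENCE LETTER ON THE CIRCLE**: `|Θ_K(u+3s) − 3Θ_K(u+2s) + 3Θ_K(u+s) − Θ_K(u)| ≤ 72π³s³` for `0 ≤ s ≤ 1∕3`, `K ≥ 2` (interior: the smooth carrier's
`6π³s³` on a common representative; near `±1` or the seam: all four values `≤ 9π³s³` by cubic flatness).
[cite: Balaban1984PropagatorsII, (2.36) p.229 («|∂^α h_□| ≤ O(1)M^{−|α|}», `|α| = 3`: shape)] -/
theorem abs_thetaPer_third_diff_le {K : ℕ} (hK : 2 ≤ K) {u s : ℝ} (hs : 0 ≤ s) (hs1 : s ≤ 1 / 3) :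
    |thetaPer K (u + 3 * s) - 3 * thetaPer K (u + 2 * s) + 3 * thetaPer K (u + s) - thetaPer K u| ≤ 72 * π ^ 3 * s ^ 3 := by
  have hK0 : 0 < K := by omega
  have hK2 : (2 : ℝ) ≤ K := by exact_mod_cast hK
  obtain ⟨j, hj⟩ : ∃ j : ℤ, j = round ((u + 3 / 2 * s) / K) := ⟨_, rfl⟩
  have ec : cenRep K (u + 3 / 2 * s) = u + 3 / 2 * s - j * K := by rw [hj]; unfold cenRep; ring
  have hv : |u + 3 / 2 * s - j * K| ≤ K / 2 := by rw [← ec]; exact abs_cenRep_le hK0 _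
  by_cases hin : |u + 3 / 2 * s - j * K| ≤ 1 - 3 / 2 * s
  · -- interior: the four points have representatives in [−1, 1]
    have hrep : ∀ a : ℝ, 0 ≤ a → a ≤ 3 * s → |u + a - j * K| ≤ 1 := by
      intro a ha0 ha3
      have hb : |(a - 3 / 2 * s)| ≤ 3 / 2 * s := abs_le.2 ⟨by linarith, by linarith⟩
      rw [show u + a - j * K = (u + 3 / 2 * s - j * K) + (a - 3 / 2 * s) by ring]
      exact (abs_add_le _ _).trans (by linarith)
    have hval : ∀ a : ℝ, 0 ≤ a → a ≤ 3 * s → thetaPer K (u + a) = Real.cos (π / 2 * phiP (u - j * K + a)) := by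
      intro a ha0 ha3
      have h1 := hrep a ha0 ha3
      rw [thetaPer_eq_of_abs_le hK0 (h1.trans (by linarith)), thetaP_of_abs_le h1, show u + a - (j : ℝ) * K = u - j * K + a by ring]
    have e3 := hval (3 * s) (by positivity) le_rfl
    have e2 := hval (2 * s) (by positivity) (by linarith)
    have e1 := hval s hs (by linarith)
    have e0 := hval 0 le_rfl (by positivity)
    rw [add_zero, add_zero] at e0
    rw [e3, e2, e1, e0]
    exact (abs_cos_phiP_third_diff_le (u - j * K) hs).trans (by nlinarith [Real.pi_pos, pow_pos Real.pi_pos 3, pow_nonneg hs 3])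
  · -- near ±1 ∕ the seam: every value is ≤ 9π³s³
    push Not at hin
    have hfar : ∀ w : ℝ, |w - (u + 3 / 2 * s)| ≤ 3 / 2 * s → thetaPer K w ≤ 9 * π ^ 3 * s ^ 3 := by
      intro w hw
      unfold thetaPer
      have hlip := abs_abs_cenRep_sub_le hK0 w (u + 3 / 2 * s)
      rw [ec] at hlip
      have h1 : 1 - 3 * s ≤ |cenRep K w| := by
        have := abs_le.1 hlip
        linarith
      exact (thetaP_le_cube_of_le_abs (c := 3 * s) (by positivity) (by linarith) h1).trans (le_of_eq (by ring))
    have b3 := hfar (u + 3 * s) (by rw [show u + 3 * s - (u + 3 / 2 * s) = 3 / 2 * s by ring, abs_of_nonneg (by positivity)])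
    have b2 := hfar (u + 2 * s) (by rw [show u + 2 * s - (u + 3 / 2 * s) = 1 / 2 * s by ring, abs_of_nonneg (by positivity)]; linarith)
    have b1 := hfar (u + s) (by rw [show u + s - (u + 3 / 2 * s) = -(1 / 2 * s) by ring, abs_neg, abs_of_nonneg (by positivity)]; linarith)
    have b0 := hfar u (by rw [show u - (u + 3 / 2 * s) = -(3 / 2 * s) by ring, abs_neg, abs_of_nonneg (by positivity)])
    have p3 := thetaPer_nonneg K (u + 3 * s)
    have p2 := thetaPer_nonneg K (u + 2 * s)
    have p1 := thetaPer_nonneg K (u + s)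
    have p0 := thetaPer_nonneg K u
    rw [abs_le]; constructor <;> linarith

end Summit.QuantumFields.YangMills.BalabanUVNodes.N15.Gluing

end
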